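import Literature.AlgebraicGeometry.Frobenioids.SubAmpleTestFrobenioid
import Literature.AlgebraicGeometry.Frobenioids.FiberProductsMorphisms
import HarnessLib

/-!
# Frobenioids I, Proposition 1.6 (vi), clause «Aut^sub-ample»: a second, independent kernel witness
# (the `SubAmpleTest` chain)

Mochizuki, *The geometry of Frobenioids I: the general theory*, Kyushu J. Math. **62** (2008)
293–400, §1, Proposition 1.6 (vi), kurims text p. 28 [cite: MochizukiFrdI2008, Prop. 1.6(vi) p.28]
("(vi) A object of `C′` is Aut-ample (respectively, Aut^sub-ample; End-ample) if it projects to such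
an object of `C`"; proof p. 28: "Now assertion (vi) follows immediately from the definitions").

The clause «Aut^sub-ample» is the named statement `PreFrobenioid.Prop16viAutSubAmpleIf`
(`FiberProductsAutSubAmpleStatement.lean`); its refutation OF RECORD is
`AutSubAmpleCex.not_prop16viAutSubAmpleIf` (`AutSubAmpleFiberProductCounterexample.lean`, seat
abc-iut-w5-d202, finding F-w5d202-1: base change along a WIDE SUBCATEGORY).  THIS FILE completes the
independent `SubAmpleTest` witness of seat abc-iut-found gen 2 (`SubAmpleTestBase.lean`,
`SubAmpleTestFrobenioid.lean`), found concurrently, whose base change is instead a NON-FAITHFUL functor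
`κ : D → D` with `D′ = D`: so the clause fails for both kinds of `D′ → D` allowed by Prop. 1.6.  The
negation of the named clause is NOT re-derived here (it would restate the theorem of record); the data
below instantiate every hypothesis of `PreFrobenioid.Prop16viAutSubAmpleIf` (`SubAmpleTest.isFrobenioid`,
`isGraphConnected`, `isTotallyEpimorphic`, `κ_map_isFSM`) and contradict its conclusion
(`exists_fst_autSubAmple_not_autSubAmple`).

WITNESS (OURS).  Base `D` = `SubAmpleTestBase.lean` (objects `P`, `Q`, `E`; `f 1 : Q → Q` a
non-invertible sub-automorphism, witnessed over `P` by `b (−1) ≫ φ 0 = φ 0 ≫ f 1` and over `E` by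
`c (−1) ≫ h 0 = h 0 ≫ f 1`).  Frobenioid `C` = the model Frobenioid ([FrdI] Thm. 5.2) of `(Φt, 0_D, 0)`
with `Φt(P) = Φt(Q) = ℝ_{≥0}`, `Φt(E) = L` the lexicographic cone (`SubAmpleTestFrobenioid.lean`);
`D′ := D`, `D′ → D := κ` (collapse `E ↦ P`), `C′ = C ×_D D`.
(1) `A = (Q, −1)` IS `Aut^sub`-ample in `C` (`isAutSubAmple_A`): every `f j` lifts to the endomorphism
`a_j = (1, f j, 1 − 4^{-j})` of `A`, a sub-automorphism WITNESSED OVER `E`: on `Y = (E, −(0,1))` the arrow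
`ψ = (1, h 0, (−1, 1)) : Y → A` and the automorphism `β = (1, c (−j), 0)` satisfy `β ≫ ψ = ψ ≫ a_j`
(the real coordinate `−1` of `Div ψ` is absorbed by the lexicographically dominant `(0, 1)`).
(2) `X = (A, Q, id)` is NOT `Aut^sub`-ample in `C′` (`not_isAutSubAmple_X`): a lift of `f 1` to a
sub-automorphism of `X` would have a witness whose `D`-component is `(P, φ i, b (−1))` or
`(E, h i, c (−1))`, hence (via `κ`) whose `C`-component is an object `(P, γ)` with an automorphism over
`b (−1)` of zero divisor; the automorphism forces `γ = 4^{-1}·γ`, i.e. `γ = 0`, and then an arrow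
`(P, 0) → (Q, −1)` over `φ i` would need the zero divisor `−2^i < 0` — impossible.  The obstruction is
exactly the one the typer (abc-iut-found gen 0) recorded: the `C`-witness of the lift and the
`D′`-witness of `f` must have MATCHING bases, and nothing in the definitions forces it.  Repaired (true)
form: `PreFrobenioid.isAutSubAmple_fiberProduct_of_pullback_lifts` (`FiberProductsAutSubAmplePullback.lean`).
Neutral record under the cell's typing; the sibling clauses «Aut-ample», «End-ample» are TRUE
(`isAutAmple_fiberProduct_of_fst`, `isEndAmple_fiberProduct_of_fst`).  Nothing here bears on
[IUTchIII] Cor. 3.12.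
-/

noncomputable section

open scoped NNReal

namespace Literature.AlgebraicGeometry.Frobenioids

open CategoryTheory Opposite

namespace SubAmpleTest

open PreFrobenioid ModelFrobenioid

/-! ### Bookkeeping in `M^gp` -/

/-- In `M^gp`: if `b · c = a` in `M`, then `a⁻¹ · b = c⁻¹` (as `AutSubAmpleCex.inv_of_mul_of`).
[cite: MochizukiFrdI2008, §0 p.11] -/
private theorem of_inv_mul_of {M : Type} [CommMonoid M] {a b c : M} (h : b * c = a) :
    (Algebra.GrothendieckGroup.of a)⁻¹ * Algebra.GrothendieckGroup.of b =
      (Algebra.GrothendieckGroup.of c)⁻¹ := by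
  rw [← h, map_mul, mul_inv_rev, mul_assoc, inv_mul_cancel, mul_one]

/-- `(c k)^*` fixes `(0, 1) ∈ L`. [cite: MochizukiFrdI2008, Def. 1.1(ii) p.19] -/
theorem lexScale_e01 (t : ℝ≥0) : lexScale t e01 = e01 := L_ext (by simp)

/-- Every endomorphism of `Q` in `D` is an `f j`. [cite: MochizukiFrdI2008, Prop. 1.6(vi) p.28] -/
theorem exists_eq_f (g : Dob.Q ⟶ Dob.Q) : ∃ j : ℕ, g = Dhom.f j := by
  cases g with
  | f j => exact ⟨j, rfl⟩

/-- Every arrow `P → Q` in `D` is a `φ i`. [cite: MochizukiFrdI2008, Prop. 1.6(vi) p.28] -/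
theorem exists_eq_φ (g : Dob.P ⟶ Dob.Q) : ∃ i : ℤ, g = Dhom.φ i := by
  cases g with
  | φ i => exact ⟨i, rfl⟩

/-- Every endomorphism of `P` in `D` is a `b k`. [cite: MochizukiFrdI2008, Prop. 1.6(vi) p.28] -/
theorem exists_eq_b (g : Dob.P ⟶ Dob.P) : ∃ k : ℤ, g = Dhom.b k := by
  cases g with
  | b k => exact ⟨k, rfl⟩

/-- Every arrow `E → Q` in `D` is an `h i`. [cite: MochizukiFrdI2008, Prop. 1.6(vi) p.28] -/
theorem exists_eq_h (g : Dob.E ⟶ Dob.Q) : ∃ i : ℤ, g = Dhom.h i := by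
  cases g with
  | h i => exact ⟨i, rfl⟩

/-- Every endomorphism of `E` in `D` is a `c k`. [cite: MochizukiFrdI2008, Prop. 1.6(vi) p.28] -/
theorem exists_eq_c (g : Dob.E ⟶ Dob.E) : ∃ k : ℤ, g = Dhom.c k := by
  cases g with
  | c k => exact ⟨k, rfl⟩

/-- `Φt^gp`-transport of a negative class: `u^*(−x) = −(u^* x)`. [cite: MochizukiFrdI2008, Thm. 5.2(i) p.100] -/
theorem pullGp_inv_of {U V : Dob} (u : U ⟶ V) (x : Φt.obj (op V)) :
    pullGp Φt u (Algebra.GrothendieckGroup.of x)⁻¹ = (Algebra.GrothendieckGroup.of (pull Φt u x))⁻¹ := by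
  rw [map_inv, pullGp_of']

/-- `qel x` in additive coordinates. [cite: MochizukiFrdI2008, Thm. 5.2(i) p.100] -/
@[simp] theorem toAdd_qel (x : ℝ≥0) : Multiplicative.toAdd (α := ℝ≥0) (qel x) = x := rfl

/-! ### (1) `A = (Q, −1)` is `Aut^sub`-ample in `C` -/

/-- The relation of the lift `a_j = (1, f j, 1 − 4^{-j}) : A → A`: `−1 + (1 − 4^{-j}) = 4^{-j}·(−1)`.
[cite: MochizukiFrdI2008, Thm. 5.2(i) p.100] -/
theorem rel_lift (j : ℕ) :
    A.cls ^ ((1 : ℕ+) : ℕ) * Algebra.GrothendieckGroup.of (qel (1 - tw (-(2 * (j : ℤ))))) =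
      pullGp Φt (Dhom.f j : Dob.Q ⟶ Dob.Q) A.cls * divB Φt (zeroMonoid.{0} Dob) divZero (op Dob.Q) 1 := by
  have hle : tw (-(2 * (j : ℤ))) ≤ 1 := tw_le_one (by omega)
  have hq : (qel (1 - tw (-(2 * (j : ℤ)))) * qel (tw (-(2 * (j : ℤ))) * 1) : Multiplicative ℝ≥0) =
      qel 1 := by
    change Multiplicative.ofAdd (1 - tw (-(2 * (j : ℤ)))) * Multiplicative.ofAdd (tw (-(2 * (j : ℤ))) * 1) =
      Multiplicative.ofAdd 1
    rw [← ofAdd_add, mul_one, tsub_add_cancel_of_le hle]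
  rw [PNat.one_coe, pow_one, divB_divZero, mul_one, pullGp_inv_of]
  exact of_inv_mul_of hq

/-- The relation of the witness arrow `ψ = (1, h 0, (−1, 1)) : Y → A`: `−(0,1) + (−1, 1) = (h 0)^*(−1)`.
[cite: MochizukiFrdI2008, Thm. 5.2(i) p.100] -/
theorem rel_wit :
    Y.cls ^ ((1 : ℕ+) : ℕ) * Algebra.GrothendieckGroup.of (eel (-1) 1 (fun h => absurd h one_ne_zero)) =
      pullGp Φt (Dhom.h 0 : Dob.E ⟶ Dob.Q) A.cls * divB Φt (zeroMonoid.{0} Dob) divZero (op Dob.E) 1 := by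
  have hq : (eel (-1) 1 (fun h => absurd h one_ne_zero) * lexEmb (tw 0) (Multiplicative.ofAdd (1 : ℝ≥0)) : L) =
      e01 :=
    L_ext (by rw [pr_mul, pr_lexEmb, pr_e01]; simp)
  rw [PNat.one_coe, pow_one, divB_divZero, mul_one, pullGp_inv_of]
  exact of_inv_mul_of hq

/-- The relation of the automorphism `β = (1, c k, 0)` of `Y`: `(c k)^*` fixes `−(0, 1)`.
[cite: MochizukiFrdI2008, Thm. 5.2(i) p.100] -/
theorem rel_aut (k : ℤ) :
    Y.cls ^ ((1 : ℕ+) : ℕ) * Algebra.GrothendieckGroup.of (1 : Φt.obj (op Dob.E)) =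
      pullGp Φt (Dhom.c k : Dob.E ⟶ Dob.E) Y.cls * divB Φt (zeroMonoid.{0} Dob) divZero (op Dob.E) 1 := by
  rw [PNat.one_coe, pow_one, divB_divZero, mul_one, map_one, mul_one, pullGp_inv_of, pull_c, lexScale_e01]

/-- **`A = (Q, −1)` is `Aut^sub`-ample in `C`**: every sub-automorphism `f j` of `Q = A_D` lifts to the
sub-automorphism `a_j = (1, f j, 1 − 4^{-j})` of `A`, witnessed over `E` by
`β = (1, c (−j), 0) ∈ Aut(Y)`, `ψ = (1, h 0, (−1, 1)) : Y → A`, `β ≫ ψ = ψ ≫ a_j`.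
[cite: MochizukiFrdI2008, Prop. 1.6(vi) p.28] -/
theorem isAutSubAmple_A : IsAutSubAmple F A := by
  intro g _
  obtain ⟨j, rfl⟩ := exists_eq_f g
  have hle : tw (-(2 * (j : ℤ))) ≤ 1 := tw_le_one (by omega)
  -- the automorphism `β = (1, c (-j), 0)` of `Y`
  have hβ : IsIso (mkHom Y Y 1 (Dhom.c (-j)) 1 1 (rel_aut (-j))) := by
    haveI : IsIso (baseMap (mkHom Y Y 1 (Dhom.c (-j)) 1 1 (rel_aut (-j)))) := isIso_c (-j)
    exact isIso_of isGroupLike_zeroMonoid _ rfl rfl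
  refine ⟨mkHom A A 1 (Dhom.f j) (qel (1 - tw (-(2 * (j : ℤ))))) 1 (rel_lift j),
    ⟨Y, mkHom Y A 1 (Dhom.h 0) (eel (-1) 1 (fun h => absurd h one_ne_zero)) 1 rel_wit,
      @asIso _ _ _ _ _ hβ, ?_⟩, rfl⟩
  -- `β ≫ ψ = ψ ≫ a_j`
  refine ModelFrobenioid.hom_ext rfl ?_ ?_ (Subsingleton.elim _ _)
  · rw [asIso_hom, baseMap_comp, baseMap_comp, baseMap_mkHom, baseMap_mkHom, baseMap_mkHom, c_comp_h,
      h_comp_f, h_inj]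
    ring
  · rw [asIso_hom, div_comp_pull, div_comp_pull, baseMap_mkHom, baseMap_mkHom, div_mkHom, div_mkHom,
      div_mkHom, degFr_mkHom, degFr_mkHom, PNat.one_coe, pow_one, pow_one, pull_c, pull_h]
    apply L_ext
    have hc := NNReal.coe_sub hle
    have he : (2 : ℤ) * -(j : ℤ) = -(2 * (j : ℤ)) := by ring
    rw [he, pr_mul, pr_mul, pr_lexScale, pr_lexEmb, pr_one, pr_lel, add_zero, Prod.mk_add_mk,
      Prod.mk.injEq]
    refine ⟨?_, by simp⟩
    rw [toAdd_qel, hc, tw_zero, NNReal.coe_one]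
    ring

/-! ### (2) `X = (A, Q, id)` is not `Aut^sub`-ample in `C ×_D D` -/

/-- `4^{-1} = 1/4` in `ℝ`. [cite: MochizukiFrdI2008, Def. 1.1(ii) p.19] -/
theorem coe_tw_neg_two : ((tw (2 * -1) : ℝ≥0) : ℝ) = 1 / 4 := by
  rw [coe_tw, show (2 : ℤ) * -1 = -2 by norm_num, zpow_neg, zpow_ofNat]
  norm_num

/-- The only class `γ ∈ Φt(P)^gp = ℝ` fixed by `(b (−1))^* = ×4^{-1}` is `γ = 0`.
[cite: MochizukiFrdI2008, Thm. 5.2(i) p.100] -/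
theorem cls_eq_one_of_fixed (γ : Algebra.GrothendieckGroup (Φt.obj (op Dob.P)))
    (hγ : pullGp Φt (Dhom.b (-1) : Dob.P ⟶ Dob.P) γ = γ) : γ = 1 := by
  obtain ⟨x, y, hxy⟩ := gp_exists_mul_of_eq_of γ
  have h2 := congrArg (pullGp Φt (Dhom.b (-1) : Dob.P ⟶ Dob.P)) hxy
  rw [map_mul, hγ, pullGp_of', pullGp_of', pull_b, pull_b] at h2
  -- `γ = x / y = (x/4) / (y/4)`, so `x + y/4 = x/4 + y` and `x = y`
  have hx : Algebra.GrothendieckGroup.of (x * nnScale (tw (2 * -1)) y) =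
      Algebra.GrothendieckGroup.of (nnScale (tw (2 * -1)) x * y) := by
    rw [map_mul, map_mul, ← hxy, ← h2, mul_assoc, mul_assoc, mul_comm (Algebra.GrothendieckGroup.of y)]
  have hx' := congrArg Multiplicative.toAdd (Algebra.GrothendieckGroup.of_injective hx)
  rw [toAdd_mul, toAdd_mul, toAdd_nnScale, toAdd_nnScale] at hx'
  have hx3 : ((Multiplicative.toAdd x : ℝ≥0) : ℝ) = ((Multiplicative.toAdd y : ℝ≥0) : ℝ) := by
    have := congrArg (fun r : ℝ≥0 => (r : ℝ)) hx'
    simp only [NNReal.coe_add, NNReal.coe_mul, coe_tw_neg_two] at this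
    linarith
  have hxy' : x = y := Multiplicative.toAdd.injective (NNReal.coe_injective hx3)
  rw [hxy'] at hxy
  exact mul_right_cancel (hxy.trans (one_mul _).symm)

/-- There is no sub-automorphism witness over `P` for a lift of `f 1`: an object `(P, γ)` of `C` with an
automorphism `β₁` over `b (−1)` admits no arrow to `A = (Q, −1)` (for `β₁` forces `γ = 0`, and an arrow
`(P, 0) → (Q, −1)` over `φ i` would have zero divisor `−2^i`). [cite: MochizukiFrdI2008, Prop. 1.6(vi) p.28] -/
theorem false_of_witness_over_P (γ : Algebra.GrothendieckGroup (Φt.obj (op Dob.P)))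
    (β₁ : (⟨Dob.P, γ⟩ : C) ⟶ ⟨Dob.P, γ⟩) [IsIso β₁] (hb : baseMap β₁ = Dhom.b (-1))
    (ψ₁ : (⟨Dob.P, γ⟩ : C) ⟶ A) : False := by
  -- `β₁` has degree 1 and zero divisor 0, so its relation reads `γ = (b (-1))^* γ`
  have hrel := ModelFrobenioid.rel β₁
  rw [degFr_eq_one_of_isIso β₁, div_eq_one_of_isIso isDivisorial_Φt β₁, hb, PNat.one_coe, pow_one,
    map_one, mul_one, divB_divZero, mul_one] at hrel
  have hγ : γ = 1 := cls_eq_one_of_fixed γ hrel.symm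
  subst hγ
  -- an arrow `(P, 0) → (Q, -1)` over `φ i` is impossible
  obtain ⟨i, hi⟩ := exists_eq_φ (baseMap ψ₁)
  have hrel' := ModelFrobenioid.rel ψ₁
  rw [one_pow, one_mul, divB_divZero, mul_one, hi, pullGp_inv_of, pull_φ,
    eq_inv_iff_mul_eq_one, ← map_mul] at hrel'
  have h1 : (div ψ₁ * nnScale (tw i) (Multiplicative.ofAdd 1) : Multiplicative ℝ≥0) = 1 :=
    Algebra.GrothendieckGroup.of_injective (hrel'.trans (map_one _).symm)
  have h0 : Multiplicative.toAdd (α := ℝ≥0) (div ψ₁) + tw i = 0 := by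
    have := congrArg (fun z : Multiplicative ℝ≥0 => Multiplicative.toAdd z) h1
    simpa only [toAdd_mul, toAdd_nnScale, toAdd_ofAdd, toAdd_one, mul_one] using this
  have hle : tw i ≤ 0 :=
    calc tw i ≤ Multiplicative.toAdd (α := ℝ≥0) (div ψ₁) + tw i := le_add_self
      _ = 0 := h0
  exact tw_ne_zero i (le_antisymm hle zero_le)

/-- The common end of the two non-trivial cases: a `C′`-witness whose `C`-component lives over `P` with
its automorphism over `b (−1)`. [cite: MochizukiFrdI2008, Prop. 1.6(vi) p.28] -/
theorem false_of_witness (Wb : Dob) (γ : Algebra.GrothendieckGroup (Φt.obj (op Wb)))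
    (ε : (Wb : Dob) ≅ Dob.P) (β₁ : (⟨Wb, γ⟩ : C) ⟶ ⟨Wb, γ⟩) (hβ1 : IsIso β₁)
    (hβw : (baseMap β₁ ≫ ε.hom : Wb ⟶ Dob.P) = ε.hom ≫ Dhom.b (-1))
    (ψ₁ : (⟨Wb, γ⟩ : C) ⟶ A) : False := by
  cases Wb with
  | Q => exact nomatch ε.hom
  | E => exact nomatch ε.hom
  | P =>
    obtain ⟨kβ, hkβ⟩ := exists_eq_b (baseMap β₁)
    obtain ⟨m, hm⟩ := exists_eq_b ε.hom
    rw [hkβ, hm, b_comp_b, b_comp_b, b_inj] at hβw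
    have hk : kβ = -1 := by omega
    subst hk
    exact false_of_witness_over_P γ β₁ hkβ ψ₁

/-- **`X = (A, Q, id)` is NOT `Aut^sub`-ample in `C′ = C ×_D D`**: the sub-automorphism `f 1` of
`Q = X_{D′}` does not lift to a sub-automorphism of `X`. [cite: MochizukiFrdI2008, Prop. 1.6(vi) p.28] -/
theorem not_isAutSubAmple_X : ¬ IsAutSubAmple (fiberProductFunctor F κ) X := by
  intro hX
  obtain ⟨α, ⟨W, ψ, β, hrel⟩, hα⟩ := hX (Dhom.f 1) f_one_mem_autSub
  have hα' : α.snd = Dhom.f 1 := hα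
  have h2 : β.hom.snd ≫ ψ.snd = ψ.snd ≫ Dhom.f 1 := by
    rw [← hα']; exact congrArg CFP.Hom.snd hrel
  have hβw : baseMap β.hom.fst ≫ W.iso.hom = W.iso.hom ≫ κ.map β.hom.snd := β.hom.w
  have hβ2 : IsIso β.hom.snd := CFP.isIso_snd β.hom
  have hβ1 : IsIso β.hom.fst := CFP.isIso_fst β.hom
  generalize β.hom.fst = β₁ at hβ1 hβw
  generalize β.hom.snd = β₂ at hβ2 hβw h2
  generalize ψ.fst = ψ₁ at hβw
  generalize ψ.snd = ψ₂ at h2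
  clear hrel hα hα'
  obtain ⟨⟨Wb, γ⟩, Ws, ε⟩ := W
  cases Ws with
  | Q =>
    obtain ⟨l, rfl⟩ := exists_eq_f ψ₂
    obtain ⟨m, rfl⟩ := exists_eq_f β₂
    have hm : m = 0 := f_eq_zero_of_isIso m hβ2
    rw [f_comp_f, f_comp_f, f_inj] at h2
    omega
  | P =>
    obtain ⟨i, rfl⟩ := exists_eq_φ ψ₂
    obtain ⟨k, rfl⟩ := exists_eq_b β₂
    rw [b_comp_φ, φ_comp_f, φ_inj] at h2
    have hk : k = -1 := by omega
    subst hk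
    exact false_of_witness Wb γ ε β₁ hβ1 hβw ψ₁
  | E =>
    obtain ⟨i, rfl⟩ := exists_eq_h ψ₂
    obtain ⟨k, rfl⟩ := exists_eq_c β₂
    rw [c_comp_h, h_comp_f, h_inj] at h2
    have hk : k = -1 := by omega
    subst hk
    exact false_of_witness Wb γ ε β₁ hβ1 hβw ψ₁

/-! ### The witness, packaged -/

/-- The witness, packaged: along `κ : D → D` (FSM-preserving: `κ_map_isFSM`; `D` connected and totally
epimorphic: `isGraphConnected`, `isTotallyEpimorphic`), the object `X` of `C ×_D D` projects to the
`Aut^sub`-ample object `A` of the Frobenioid `C → F_Φt` (`isFrobenioid`) but is not `Aut^sub`-ample —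
every hypothesis of `PreFrobenioid.Prop16viAutSubAmpleIf` holds and its conclusion fails (negation of
record: `AutSubAmpleCex.not_prop16viAutSubAmpleIf`). [cite: MochizukiFrdI2008, Prop. 1.6(vi) p.28] -/
theorem exists_fst_autSubAmple_not_autSubAmple :
    ∃ A' : FiberProduct F κ, IsAutSubAmple F A'.fst ∧ ¬ IsAutSubAmple (fiberProductFunctor F κ) A' :=
  ⟨X, isAutSubAmple_A, not_isAutSubAmple_X⟩

end SubAmpleTest

end Literature.AlgebraicGeometry.Frobenioids

end
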